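import Literature.AlgebraicGeometry.Resolution.BlowupRegularPairCharts
import Literature.AlgebraicGeometry.Resolution.Lipman1969RationalSurfaceSingularities
import Literature.AlgebraicGeometry.Morphisms.CechModuleCoverIndependence
import Literature.AlgebraicGeometry.Morphisms.CechModuleUnit
import HarnessLib

/-!
# Lipman's two-chart computation: `H¹ = 0` on the blow-up of a regular pair
# (Lipman 1969, proof of Prop. (1.2), statement A), p. 200)

Topic: `Literature/AlgebraicGeometry/Resolution`. J. Lipman, *Rational singularities, with applications to
algebraic surfaces and unique factorization*, Publ. Math. IHÉS 36 (1969), proof of Prop. (1.2), statement A)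
("if `X` is any regular surface and `j : Z → X` is a quadratic transformation, then
`H¹(Z, 𝒪_Z) = H¹(X, 𝒪_X)`"), p. 200: "Since `R¹j_*(𝒪_Z)` is concentrated at the point `x` which is blown
up, we may replace `X` by an affine neighborhood `Spec(T)` of `x` which is such that `x` corresponds to a
maximal ideal in `T` generated by two elements, say `b` and `c`. We have then to show that
`H¹(Z, 𝒪_Z) = 0`. `Z` is covered by the affine open sets `U_b = Spec(T[c/b])`, `U_c = Spec(T[b/c])`. For
this covering, the alternating one-cochains with values in `𝒪_Z` are the elements of
`Γ(U_b ∩ U_c, 𝒪_Z) = T[c/b, b/c]`. Since [every monomial `(c/b)ⁱ (b/c)ʲ` lies in `T[c/b]` or in `T[b/c]`]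
every alternating one-cochain is a coboundary. Thus `H¹(Z, 𝒪_Z) = 0`."

This file proves the LOCAL statement in the tree's language of blowing ups by the universal property
(`IsBlowup`, `Blowups.lean`), principal charts (`BlowupPrincipalCharts.lean`, `BlowupRegularPairCharts.lean`:
`X′[W, u] = Spec A[X]/(uX - v)`) and Čech `Ȟ¹` of the structure sheaf (`Morphisms/CechH1`):

* `toSubmodule_adjoin_sup_toSubmodule_adjoin_of_mul_eq_one` — the algebra: for `x y = 1` in a
  `T`-algebra, `T[x] + T[y] = T[x, y]` as `T`-submodules;
* `subsingleton_cechH1_of_forall_exists_eq_res_sub_res` — two-member families: if every section on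
  `U₀ ∩ U₁` is `b|_{U₀ ∩ U₁} - a|_{U₀ ∩ U₁}` then `Ȟ¹({U₀, U₁}, 𝒪) = 0`.

(The chart-level statements — `Ȟ¹` of the two principal charts of the blow-up of a regular pair, and
`HasTrivialCechH1` of the blow-up of an affine scheme along a regular pair — are appended to this file in a
second step.) Brick (A0) of the sub-cell «(1.2) 2-reg» of the D-0154 (2) RES inputs cell (every resolution
of a two-dimensional regular local ring has `H¹ = 0`). No definitions, no named facts; Lipman's
Prop. (1.2) itself is NOT proved here.

## Sources

* J. Lipman, Publ. Math. IHÉS 36 (1969), proof of Prop. (1.2), statement A), p. 200. [Lipman1969]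
* The Stacks Project, Tag 01ED (Čech complex), Tag 0804 (charts of a blowing up). [StacksProject]
-/

noncomputable section

open CategoryTheory CategoryTheory.Limits AlgebraicGeometry TopologicalSpace Opposite Polynomial
open Literature.AlgebraicGeometry.Morphisms

namespace Literature.AlgebraicGeometry.Resolution

universe u

/-! ## The algebra: Laurent monomials split -/

/-- **`T[x] + T[y] = T[x, y]` when `x y = 1`** (as `T`-submodules of a `T`-algebra `K`): the sum is a
subalgebra, since `x · yⁿ⁺¹ = yⁿ` and `y · xⁿ⁺¹ = xⁿ` — Lipman's "every alternating one-cochain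
[an element of `T[c/b, b/c]`] is a coboundary [a sum of an element of `T[c/b]` and one of `T[b/c]`]".
[cite: Lipman1969, Proposition (1.2), proof of statement A) (p. 200)] -/
theorem toSubmodule_adjoin_sup_toSubmodule_adjoin_of_mul_eq_one {T K : Type*} [CommRing T]
    [CommRing K] [Algebra T K] {x y : K} (hxy : x * y = 1) :
    Subalgebra.toSubmodule (Algebra.adjoin T {x}) ⊔ Subalgebra.toSubmodule (Algebra.adjoin T {y}) =
      Subalgebra.toSubmodule (Algebra.adjoin T {x, y}) := by
  set S := Subalgebra.toSubmodule (Algebra.adjoin T {x}) ⊔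
    Subalgebra.toSubmodule (Algebra.adjoin T {y}) with hS
  apply le_antisymm
  · exact sup_le
      (fun z hz => Algebra.adjoin_mono (Set.singleton_subset_iff.mpr (Set.mem_insert x {y})) hz)
      (fun z hz => Algebra.adjoin_mono (Set.subset_insert x {y}) hz)
  -- the monomials `xⁱ yʲ = x^{i-j}` or `y^{j-i}` lie in `S`
  have hpow : ∀ i j : ℕ, x ^ i * y ^ j ∈ S := by
    intro i j
    rcases le_total i j with hij | hij
    · obtain ⟨k, rfl⟩ := Nat.exists_eq_add_of_le hij
      have e : x ^ i * y ^ (i + k) = y ^ k := by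
        rw [pow_add, ← mul_assoc, ← mul_pow, hxy, one_pow, one_mul]
      rw [e]
      exact Submodule.mem_sup_right (Subalgebra.pow_mem _ (Algebra.self_mem_adjoin_singleton T y) k)
    · obtain ⟨k, rfl⟩ := Nat.exists_eq_add_of_le hij
      have e : x ^ (j + k) * y ^ j = x ^ k := by
        rw [pow_add, mul_assoc, mul_comm (x ^ k), ← mul_assoc, ← mul_pow, hxy, one_pow, one_mul]
      rw [e]
      exact Submodule.mem_sup_left (Subalgebra.pow_mem _ (Algebra.self_mem_adjoin_singleton T x) k)
  -- hence `T[x] · T[y] ⊆ S`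
  have hcross : ∀ p ∈ Algebra.adjoin T {x}, ∀ q ∈ Algebra.adjoin T {y}, p * q ∈ S := by
    intro p hp q hq
    rw [Algebra.adjoin_singleton_eq_range_aeval] at hp hq
    obtain ⟨P, rfl⟩ := hp
    obtain ⟨Q, rfl⟩ := hq
    change (Polynomial.aeval x P : K) * (Polynomial.aeval y Q) ∈ S
    induction P using Polynomial.induction_on' with
    | add P₁ P₂ h₁ h₂ =>
        rw [map_add, add_mul]
        exact add_mem h₁ h₂
    | monomial i a =>
        induction Q using Polynomial.induction_on' with
        | add Q₁ Q₂ h₁ h₂ =>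
            rw [map_add, mul_add]
            exact add_mem h₁ h₂
        | monomial j b =>
            rw [Polynomial.aeval_monomial, Polynomial.aeval_monomial]
            have e : algebraMap T K a * x ^ i * (algebraMap T K b * y ^ j) = (a * b) • (x ^ i * y ^ j) := by
              rw [Algebra.smul_def, map_mul]; ring
            rw [e]
            exact S.smul_mem _ (hpow i j)
  -- so `S` is a subalgebra containing `x` and `y`
  let S' : Subalgebra T K :=
    { carrier := S
      mul_mem' := fun {p q} hp hq => by
        obtain ⟨p₁, hp₁, p₂, hp₂, rfl⟩ := Submodule.mem_sup.mp hp
        obtain ⟨q₁, hq₁, q₂, hq₂, rfl⟩ := Submodule.mem_sup.mp hq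
        rw [add_mul, mul_add, mul_add]
        refine add_mem (add_mem ?_ (hcross p₁ hp₁ q₂ hq₂)) (add_mem ?_ ?_)
        · exact Submodule.mem_sup_left (Subalgebra.mul_mem _ hp₁ hq₁)
        · rw [mul_comm]; exact hcross q₁ hq₁ p₂ hp₂
        · exact Submodule.mem_sup_right (Subalgebra.mul_mem _ hp₂ hq₂)
      one_mem' := Submodule.mem_sup_left (Subalgebra.one_mem _)
      add_mem' := fun hp hq => add_mem hp hq
      zero_mem' := S.zero_mem
      algebraMap_mem' := fun t => Submodule.mem_sup_left (Subalgebra.algebraMap_mem _ t) }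
  have hle : Algebra.adjoin T {x, y} ≤ S' := Algebra.adjoin_le (by
    intro z hz
    rcases hz with rfl | hz
    · exact Submodule.mem_sup_left (Algebra.self_mem_adjoin_singleton T _)
    · rw [Set.mem_singleton_iff] at hz
      subst hz
      exact Submodule.mem_sup_right (Algebra.self_mem_adjoin_singleton T _))
  exact fun z hz => hle hz

/-! ## Two-member families: `Ȟ¹ = 0` from surjectivity of `(a, b) ↦ b| - a|` -/

/-- **`Ȟ¹` of a two-member family vanishes when `Γ(U₀) × Γ(U₁) → Γ(U₀ ∩ U₁)`, `(a, b) ↦ b| - a|`, is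
onto.** A `1`-cocycle `c` of the family `(U₀, U₁)` has `c₀₀ = 0 = c₁₁` and `c₁₀ = -c₀₁|` (cocycle
identities at `(0,0,0)`, `(1,1,1)`, `(0,1,0)`), so it is the coboundary of `(a, b)` with `c₀₁ = b| - a|`.
[cite: StacksProject, Tag 01ED (Cohomology, Section 20.9)] -/
theorem subsingleton_cechH1_of_forall_exists_eq_res_sub_res {B : Type u} [CommRing B]
    {Z : Scheme.{u}} (f : Z ⟶ Spec (.of B)) (U : Fin 2 → Z.Opens)
    (h : ∀ s : Sections f (U 0 ⊓ U 1), ∃ (a : Sections f (U 0)) (b : Sections f (U 1)),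
      s = Sections.res f inf_le_right b - Sections.res f inf_le_left a) :
    Subsingleton (CechH1 f U) := by
  rw [Submodule.Quotient.subsingleton_iff, eq_top_iff]
  rintro ⟨c, hc⟩ -
  change c ∈ cechB1 f U
  rw [mem_cechB1_iff]
  rw [mem_cechZ1_iff] at hc
  have hcd : ∀ i j k, cechD1 f U c i j k = 0 := fun i j k => by rw [hc]; rfl
  -- restriction along an equality of opens is injective (it has a retraction)
  have res_inj : ∀ {V W : Z.Opens} (hWV : W ≤ V) (hVW : V ≤ W) (s : Sections f V),
      Sections.res f hWV s = 0 → s = 0 := by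
    intro V W hWV hVW s hs
    have h1 := congrArg (Sections.res f hVW) hs
    rwa [Sections.res_res, Sections.res_self, map_zero] at h1
  -- diagonal entries vanish: `(d¹c)_{iii} = c_{ii}| = 0`
  have hdiag : ∀ i, c i i = 0 := by
    intro i
    have h1 := hcd i i i
    rw [cechD1_apply, sub_self, zero_add] at h1
    exact res_inj _ (le_inf le_rfl inf_le_left) _ h1
  -- `c₁₀ = -c₀₁|`: `(d¹c)_{010} = c₁₀| - c₀₀| + c₀₁| = 0`
  have h10 : c 1 0 = -Sections.res f (le_inf inf_le_right inf_le_left) (c 0 1) := by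
    have h1 := hcd 0 1 0
    rw [cechD1_apply, hdiag, map_zero, sub_zero] at h1
    have h2 := congrArg (Sections.res f (W := U 1 ⊓ U 0)
      (le_inf (le_inf inf_le_right inf_le_left) inf_le_right)) h1
    rw [map_add, map_zero, Sections.res_res, Sections.res_self, Sections.res_res] at h2
    exact eq_neg_of_add_eq_zero_left h2
  -- the `0`-cochain
  obtain ⟨a, b, hab⟩ := h (c 0 1)
  let β : CechC0 f U := fun i => match i with
    | 0 => a
    | 1 => b
  refine ⟨β, funext fun i => funext fun j => ?_⟩
  revert i j
  refine Fin.forall_fin_two.mpr ⟨Fin.forall_fin_two.mpr ⟨?_, ?_⟩, Fin.forall_fin_two.mpr ⟨?_, ?_⟩⟩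
  · rw [cechD0_apply, hdiag, Sections.res_eq_res f inf_le_right inf_le_left, sub_self]
  · rw [cechD0_apply, hab]
  · rw [cechD0_apply, h10, hab, map_sub, Sections.res_res, Sections.res_res, neg_sub]
  · rw [cechD0_apply, hdiag, Sections.res_eq_res f inf_le_right inf_le_left, sub_self]

/-! ## The two principal charts of the blow-up of a regular pair -/

section TwoCharts

variable {X X' : Scheme.{u}} {π : X' ⟶ X} {I : X.IdealSheafData}

/-- **The two charts of the blow-up of a regular pair meet in `D(T)`**: for `π : X′ → X` the blowing
up along `I`, `W` affine with `I(W) = (u, v)`, and `T ∈ Γ(X′[W, u])` with `π^*v = π^*u · T`, one has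
`X′[W, u] ∩ X′[W, v] = D(T)` (Stacks 0804: the charts `Spec A[I/u]`, `Spec A[I/v]` glue along
`D(v/u) = D(u/v)`): on an affine open inside both charts `π^*u` and `π^*v` are regular generators of
the exceptional ideal, so `T` is a unit there. [cite: StacksProject, Tag 0804] -/
theorem IsBlowup.blowupChart_inf_blowupChart_eq_basicOpen_pair (hπ : IsBlowup π I)
    (W : X.affineOpens) {u v : Γ(X, W)} (huI : u ∈ I.ideal W) (hvI : v ∈ I.ideal W)
    {T : Γ(X', blowupChart π I W u)}
    (hT : π.appLE W _ (blowupChart_le_preimage π I W u) v =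
      π.appLE W _ (blowupChart_le_preimage π I W u) u * T) :
    blowupChart π I W u ⊓ blowupChart π I W v = X'.basicOpen T := by
  apply le_antisymm
  · intro x hx
    obtain ⟨W'', hW'', hxW'', hle⟩ := exists_isAffineOpen_mem_and_subset (X := X') (x := x)
      (U := blowupChart π I W u ⊓ blowupChart π I W v) hx
    have hle_u : (W'' : Set X') ⊆ (blowupChart π I W u : Set X') := fun y hy => (hle hy).1
    have hle_v : (W'' : Set X') ⊆ (blowupChart π I W v : Set X') := fun y hy => (hle hy).2
    have hPu : IsPrincipalChart π I W u ⟨W'', hW''⟩ :=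
      (hπ.isPrincipalChart_blowupChart (U := W) huI).of_le hle_u
    have hPv : IsPrincipalChart π I W v ⟨W'', hW''⟩ :=
      (hπ.isPrincipalChart_blowupChart (U := W) hvI).of_le hle_v
    -- on `W''`: `π^*u = c · π^*v`, `π^*v = π^*u · T|`, `π^*u` a nonzerodivisor
    obtain ⟨c, hc⟩ := hPv.exists_eq_mul huI
    obtain ⟨hW''le, hnzd, -⟩ := hPu
    set t : Γ(X', W'') := (X'.presheaf.map (homOfLE hle_u).op).hom T with ht
    have hT'' : π.appLE W W'' hW''le v = π.appLE W W'' hW''le u * t := by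
      rw [← map_appLE_eq (blowupChart_le_preimage π I W u) hle_u v,
        ← map_appLE_eq (blowupChart_le_preimage π I W u) hle_u u, hT]
      exact map_mul _ _ _
    have hcT : c * t = 1 := by
      have h0 : (c * t - 1) * π.appLE W W'' hW''le u = 0 := by
        have e : c * t * π.appLE W W'' hW''le u = π.appLE W W'' hW''le u := by
          calc c * t * π.appLE W W'' hW''le u = c * (π.appLE W W'' hW''le u * t) := by ring
            _ = c * π.appLE W W'' hW''le v := by rw [hT'']
            _ = π.appLE W W'' hW''le u := hc.symm
        rw [sub_mul, one_mul, e, sub_self]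
      exact sub_eq_zero.mp ((mem_nonZeroDivisors_iff.mp hnzd).2 _ h0)
    have hunit : IsUnit t := isUnit_iff_exists_inv.mpr ⟨c, by rw [mul_comm, hcT]⟩
    have hB : X'.basicOpen t = W'' := X'.basicOpen_of_isUnit hunit
    have hxB : x ∈ X'.basicOpen t := by rw [hB]; exact hxW''
    rw [ht] at hxB
    change x ∈ X'.basicOpen (X'.presheaf.map (homOfLE hle_u).op T) at hxB
    rw [Scheme.basicOpen_res] at hxB
    exact hxB.2
  · exact le_inf (X'.basicOpen_le T) (hπ.basicOpen_le_blowupChart_pair W huI hT)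

/-- **The algebra of the two charts** (abstract form of Lipman's computation): let `L` be the
localization of `R_u` away from `T`, receiving also `ρ_v : R_v → L`, compatibly with structure maps
`α_u : A → R_u`, `α_v : A → R_v`; assume `R_u` is generated by `T` over `A` and `T · ρ_v(S) = 1` for some
`S ∈ R_v`. Then every element of `L` is `ρ_v(b) - a/1`: indeed `s Tⁿ = r ∈ A[T]` gives
`s = r Sⁿ ∈ A[T] · A[S] ⊆ A[T, S] = A[T] + A[S]` (`toSubmodule_adjoin_sup_toSubmodule_adjoin_of_mul_eq_one`).
[cite: Lipman1969, Proposition (1.2), proof of statement A) (p. 200)] -/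
theorem exists_eq_sub_algebraMap_of_isLocalization_away {A Ru Rv L : Type*} [CommRing A]
    [CommRing Ru] [CommRing Rv] [CommRing L] [Algebra Ru L] (T : Ru) [IsLocalization.Away T L]
    (αu : A →+* Ru) (αv : A →+* Rv) (ρv : Rv →+* L)
    (hφ : ρv.comp αv = (algebraMap Ru L).comp αu) (S : Rv)
    (hTS : algebraMap Ru L T * ρv S = 1) (hgen : ∀ r : Ru, ∃ p : A[X], r = p.eval₂ αu T) :
    ∀ s : L, ∃ (a : Ru) (b : Rv), s = ρv b - algebraMap Ru L a := by
  letI : Algebra A L := ((algebraMap Ru L).comp αu).toAlgebra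
  have hφalg : algebraMap A L = (algebraMap Ru L).comp αu := rfl
  set x : L := algebraMap Ru L T with hxdef
  set y : L := ρv S with hydef
  -- `R_u → L` lands in `A[x]`
  have hrange_u : ∀ r : Ru, algebraMap Ru L r ∈ Algebra.adjoin A {x} := fun r => by
    obtain ⟨p, rfl⟩ := hgen r
    rw [Polynomial.hom_eval₂, ← hφalg, ← Polynomial.aeval_def]
    exact Polynomial.aeval_mem_adjoin_singleton _ _
  -- `A[x] ⊆ im (R_u → L)`, `A[y] ⊆ im ρ_v`
  have hsub_u : ∀ z ∈ Algebra.adjoin A {x}, ∃ r, algebraMap Ru L r = z := by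
    intro z hz
    rw [Algebra.adjoin_singleton_eq_range_aeval] at hz
    obtain ⟨p, rfl⟩ := hz
    refine ⟨p.eval₂ αu T, ?_⟩
    change _ = Polynomial.aeval x p
    rw [Polynomial.hom_eval₂, Polynomial.aeval_def, hφalg]
  have hsub_v : ∀ z ∈ Algebra.adjoin A {y}, ∃ r, ρv r = z := by
    intro z hz
    rw [Algebra.adjoin_singleton_eq_range_aeval] at hz
    obtain ⟨p, rfl⟩ := hz
    refine ⟨p.eval₂ αv S, ?_⟩
    change _ = Polynomial.aeval y p
    rw [Polynomial.hom_eval₂, Polynomial.aeval_def, hφalg, hφ]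
  intro s
  obtain ⟨⟨r, ⟨_, n, rfl⟩⟩, hs⟩ := IsLocalization.surj (Submonoid.powers T) s
  -- `s xⁿ = r/1`, so `s = (r/1) · yⁿ ∈ A[x] · A[y] ⊆ A[x, y] = A[x] + A[y]`
  have hs' : s = algebraMap Ru L r * y ^ n := by
    have h1 : s * x ^ n = algebraMap Ru L r := by rw [hxdef, ← map_pow]; exact hs
    rw [← h1, mul_assoc, ← mul_pow, hTS, one_pow, mul_one]
  have hmem : s ∈ Subalgebra.toSubmodule (Algebra.adjoin A {x, y}) := by
    rw [hs']
    exact Subalgebra.mul_mem _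
      (Algebra.adjoin_mono (Set.singleton_subset_iff.mpr (Set.mem_insert x {y})) (hrange_u r))
      (Subalgebra.pow_mem _ (Algebra.subset_adjoin (Set.mem_insert_of_mem x (Set.mem_singleton y))) n)
  rw [← toSubmodule_adjoin_sup_toSubmodule_adjoin_of_mul_eq_one hTS, Submodule.mem_sup] at hmem
  obtain ⟨z₁, hz₁, z₂, hz₂, hz⟩ := hmem
  obtain ⟨a, ha⟩ := hsub_u z₁ hz₁
  obtain ⟨b, hb⟩ := hsub_v z₂ hz₂
  exact ⟨-a, b, by rw [map_neg, sub_neg_eq_add, hb, ha, add_comm, hz]⟩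

/-- **Lipman's two-chart computation: `Ȟ¹({X′[W,u], X′[W,v]}, 𝒪_{X′}) = 0`** for the blowing up
`π : X′ → X` along `I` and an affine open `W` with `I(W) = (u, v)`, where `(u, v)` and `(v, u)` are
regular pairs of `A = Γ(X, W)` (e.g. a regular system of parameters of a two-dimensional regular local
ring): the charts are `X′[W, u] = Spec A[X]/(uX - v)` (`T = X̄ = π^*v/π^*u`), `X′[W, v] = Spec A[Y]/(vY - u)`
(`S = Ȳ`), they meet in `D(T)`, where `Γ(D(T)) = Γ(X′[W,u])[1/T]` and `T S = 1`; a section `s` on the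
overlap has `s Tⁿ ∈ A[T]`, so `s ∈ A[T] · A[S] ⊆ A[T, S] = A[T] + A[S]`
(`toSubmodule_adjoin_sup_toSubmodule_adjoin_of_mul_eq_one`) is a difference of restrictions from the two
charts, and `subsingleton_cechH1_of_forall_exists_eq_res_sub_res` applies — "every alternating
one-cochain is a coboundary". The base ring `B` of the Čech groups is arbitrary.
[cite: Lipman1969, Proposition (1.2), proof of statement A) (p. 200)] [cite: StacksProject, Tag 0804] -/
theorem IsBlowup.subsingleton_cechH1_blowupChart_pair (hπ : IsBlowup π I) (W : X.affineOpens)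
    {u v : Γ(X, W)} (hI : I.ideal W = Ideal.span {u, v})
    (hu : u ∈ nonZeroDivisors Γ(X, W)) (huv : ∀ r : Γ(X, W), u ∣ r * v → u ∣ r)
    (hv : v ∈ nonZeroDivisors Γ(X, W)) (hvu : ∀ r : Γ(X, W), v ∣ r * u → v ∣ r)
    {B : Type u} [CommRing B] (f : X' ⟶ Spec (.of B)) :
    Subsingleton (CechH1 f ![blowupChart π I W u, blowupChart π I W v]) := by
  have huI : u ∈ I.ideal W := hI ▸ Ideal.subset_span (by simp)
  have hvI : v ∈ I.ideal W := hI ▸ Ideal.subset_span (by simp)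
  have hI' : I.ideal W = Ideal.span {v, u} := by rw [hI, Set.pair_comm]
  -- the two charts, their coordinates `T`, `S` and the relations `π^*v = π^*u T`, `π^*u = π^*v S`
  have hVuW := blowupChart_le_preimage π I W u
  have hVvW := blowupChart_le_preimage π I W v
  have hVu_aff : IsAffineOpen (blowupChart π I W u) := hπ.isAffineOpen_blowupChart huI
  obtain ⟨eu, heu⟩ := hπ.exists_ringEquiv_blowupChart_pair W hI hu huv
  obtain ⟨ev, hev⟩ := hπ.exists_ringEquiv_blowupChart_pair W hI' hv hvu
  set T : Γ(X', blowupChart π I W u) := eu.symm (Ideal.Quotient.mk _ Polynomial.X) with hTdef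
  set S : Γ(X', blowupChart π I W v) := ev.symm (Ideal.Quotient.mk _ Polynomial.X) with hSdef
  have hTrel : π.appLE W _ hVuW v = π.appLE W _ hVuW u * T :=
    appLE_eq_mul_of_ringEquiv_blowupChart_pair W hVuW eu heu
  have hSrel : π.appLE W _ hVvW u = π.appLE W _ hVvW v * S :=
    appLE_eq_mul_of_ringEquiv_blowupChart_pair W hVvW ev hev
  obtain ⟨_, hunzd₀, -⟩ := hπ.isPrincipalChart_blowupChart (U := W) huI
  -- the overlap `D(T)`
  have hO : blowupChart π I W u ⊓ blowupChart π I W v = X'.basicOpen T :=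
    hπ.blowupChart_inf_blowupChart_eq_basicOpen_pair W huI hvI hTrel
  have hDu : X'.basicOpen T ≤ blowupChart π I W u := X'.basicOpen_le T
  have hDv : X'.basicOpen T ≤ blowupChart π I W v := hπ.basicOpen_le_blowupChart_pair W huI hTrel
  have hDW : X'.basicOpen T ≤ π ⁻¹ᵁ (W : X.Opens) := hDu.trans hVuW
  -- rings: `L = Γ(D(T)) = Γ(X'[W,u])[1/T]`; the base `A = Γ(X, W)` acts through `π^*`
  haveI : IsLocalization.Away T Γ(X', X'.basicOpen T) := hVu_aff.isLocalization_basicOpen T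
  have hρu : ∀ r, algebraMap Γ(X', blowupChart π I W u) Γ(X', X'.basicOpen T) r =
      X'.presheaf.map (homOfLE hDu).op r := fun r => rfl
  let ρv : Γ(X', blowupChart π I W v) →+* Γ(X', X'.basicOpen T) :=
    (X'.presheaf.map (homOfLE hDv).op).hom
  have hφu : ∀ a, algebraMap _ Γ(X', X'.basicOpen T) (π.appLE W _ hVuW a) =
      π.appLE W (X'.basicOpen T) hDW a := fun a => by
    rw [hρu]; exact map_appLE_eq hVuW hDu a
  have hφv : ∀ a, ρv (π.appLE W _ hVvW a) = π.appLE W (X'.basicOpen T) hDW a := fun a =>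
    map_appLE_eq hVvW hDv a
  have hφ : ρv.comp (π.appLE W _ hVvW).hom =
      (algebraMap _ Γ(X', X'.basicOpen T)).comp (π.appLE W _ hVuW).hom :=
    RingHom.ext fun a => (hφv a).trans (hφu a).symm
  -- `T S = 1` on the overlap (`π^*u` is a nonzerodivisor of the localization)
  have hTS : algebraMap _ Γ(X', X'.basicOpen T) T * ρv S = 1 := by
    have hux : π.appLE W (X'.basicOpen T) hDW v =
        π.appLE W (X'.basicOpen T) hDW u * algebraMap _ Γ(X', X'.basicOpen T) T := by
      rw [← hφu, ← hφu, hTrel]; exact map_mul _ _ _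
    have hvy : π.appLE W (X'.basicOpen T) hDW u = π.appLE W (X'.basicOpen T) hDW v * ρv S := by
      rw [← hφv, ← hφv, hSrel]; exact map_mul _ _ _
    have hunzd : π.appLE W (X'.basicOpen T) hDW u ∈ nonZeroDivisors Γ(X', X'.basicOpen T) := by
      rw [← hφu]
      exact IsLocalization.nonZeroDivisors_le_comap (Submonoid.powers T) _ hunzd₀
    have h0 : (algebraMap _ Γ(X', X'.basicOpen T) T * ρv S - 1) * π.appLE W (X'.basicOpen T) hDW u = 0 := by
      rw [sub_mul, one_mul, sub_eq_zero, mul_comm, ← mul_assoc, ← hux, ← hvy]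
    exact sub_eq_zero.mp ((mem_nonZeroDivisors_iff.mp hunzd).2 _ h0)
  -- `Γ(X'[W,u])` is generated by `T` over `A`: `Γ(X'[W,u]) ≅ A[X]/(uX - v)`, `X ↦ T`
  have hgen : ∀ r : Γ(X', blowupChart π I W u), ∃ p : (Γ(X, W))[X],
      r = p.eval₂ (π.appLE W _ hVuW).hom T := by
    intro r
    obtain ⟨p, hp⟩ := Ideal.Quotient.mk_surjective (eu r)
    refine ⟨p, ?_⟩
    have hcomp : eu.symm.toRingHom.comp (Ideal.Quotient.mk _) =
        Polynomial.eval₂RingHom (π.appLE W _ hVuW).hom T := by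
      apply Polynomial.ringHom_ext
      · intro a
        change eu.symm (Ideal.Quotient.mk _ (C a)) = _
        rw [Polynomial.coe_eval₂RingHom, Polynomial.eval₂_C, ← heu, RingEquiv.symm_apply_apply]
      · change eu.symm (Ideal.Quotient.mk _ Polynomial.X) = _
        rw [Polynomial.coe_eval₂RingHom, Polynomial.eval₂_X]
    have h1 := congrArg (fun g : (Γ(X, W))[X] →+* Γ(X', blowupChart π I W u) => g p) hcomp
    simp only [RingHom.coe_comp, Function.comp_apply, Polynomial.coe_eval₂RingHom] at h1
    rw [← h1]
    change r = eu.symm (Ideal.Quotient.mk _ p)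
    rw [hp, RingEquiv.symm_apply_apply]
  -- every section on `D(T)` is `ρv b - ρu a`
  have hsplit := exists_eq_sub_algebraMap_of_isLocalization_away T (π.appLE W _ hVuW).hom
    (π.appLE W _ hVvW).hom ρv hφ S hTS hgen
  -- transport to the overlap `X'[W,u] ∩ X'[W,v] = D(T)` and conclude
  have h1 : X'.basicOpen T ≤ blowupChart π I W u ⊓ blowupChart π I W v := le_inf hDu hDv
  have h2 : blowupChart π I W u ⊓ blowupChart π I W v ≤ X'.basicOpen T := hO.le
  have key : ∀ s : Sections f (blowupChart π I W u ⊓ blowupChart π I W v),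
      ∃ (a : Sections f (blowupChart π I W u)) (b : Sections f (blowupChart π I W v)),
        s = Sections.res f inf_le_right b - Sections.res f inf_le_left a := by
    intro s
    obtain ⟨a, b, hab⟩ := hsplit (Sections.res f h1 s)
    refine ⟨a, b, ?_⟩
    have hab' : Sections.res f h1 s = Sections.res f hDv b - Sections.res f hDu a := hab
    have hs : s = Sections.res f h2 (Sections.res f h1 s) := by
      rw [Sections.res_res, Sections.res_self]
    rw [hs, hab', map_sub, Sections.res_res, Sections.res_res]
  exact subsingleton_cechH1_of_forall_exists_eq_res_sub_res f _ key

/-- **`H¹(Bl_{(u,v)} X, 𝒪) = 0` for `X` affine** — Lipman's A), local form: "Thus `H¹(Z, 𝒪_Z) = 0`."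
For the blowing up `π : X′ → X` along `I` with `X = W` affine, `I(W) = (u, v)` and `(u, v)`, `(v, u)`
regular pairs of `Γ(X, W)`, the two principal charts cover `X′`, so by
`IsBlowup.subsingleton_cechH1_blowupChart_pair` and independence of the affine cover
(`subsingleton_cechMH1_iff_of_isAffineOpen`) every finite affine open cover `𝒱` of `X′` has
`Ȟ¹(𝒱, 𝒪_{X′}) = 0`: `HasTrivialCechH1 f` for any affine base structure `f : X′ → Spec B` (e.g. `f = π`
when `X = Spec B`). [cite: Lipman1969, Proposition (1.2), proof of statement A) (p. 200)] -/
theorem IsBlowup.hasTrivialCechH1_of_ideal_eq_span_pair (hπ : IsBlowup π I) (W : X.affineOpens)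
    (hW : (W : X.Opens) = ⊤) {u v : Γ(X, W)} (hI : I.ideal W = Ideal.span {u, v})
    (hu : u ∈ nonZeroDivisors Γ(X, W)) (huv : ∀ r : Γ(X, W), u ∣ r * v → u ∣ r)
    (hv : v ∈ nonZeroDivisors Γ(X, W)) (hvu : ∀ r : Γ(X, W), v ∣ r * u → v ∣ r)
    {B : Type u} [CommRing B] (f : X' ⟶ Spec (.of B)) :
    HasTrivialCechH1 f := by
  intro κ _ V hV hVcov
  have huI : u ∈ I.ideal W := hI ▸ Ideal.subset_span (by simp)
  have hvI : v ∈ I.ideal W := hI ▸ Ideal.subset_span (by simp)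
  -- the two charts: affine, covering `X'`
  have hUaff : ∀ i, IsAffineOpen (![blowupChart π I W u, blowupChart π I W v] i) :=
    Fin.forall_fin_two.mpr ⟨hπ.isAffineOpen_blowupChart huI, hπ.isAffineOpen_blowupChart hvI⟩
  have hUcov : ⨆ i, ![blowupChart π I W u, blowupChart π I W v] i = ⊤ := by
    refine top_le_iff.mp fun z _ => ?_
    have hz : z ∈ blowupChart π I W u ⊔ blowupChart π I W v := by
      rw [hπ.blowupChart_sup_blowupChart_pair W hI]
      change π z ∈ (W : X.Opens)
      rw [hW]
      trivial
    rcases Opens.mem_sup.mp hz with h | h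
    · exact Opens.mem_iSup.mpr ⟨0, h⟩
    · exact Opens.mem_iSup.mpr ⟨1, h⟩
  have h0 := hπ.subsingleton_cechH1_blowupChart_pair W hI hu huv hv hvu f
  have h0' : Subsingleton (CechMH1 f (SheafOfModules.unit X'.ringCatSheaf)
      ![blowupChart π I W u, blowupChart π I W v]) := by rwa [CechMH1_unit]
  have h1 := (subsingleton_cechMH1_iff_of_isAffineOpen f
    Literature.AlgebraicGeometry.Modules.IsAffineLocalizing.unit _ V hUaff hV hUcov hVcov).mp h0'
  rwa [CechMH1_unit] at h1

end TwoCharts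

end Literature.AlgebraicGeometry.Resolution

end
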